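import Summits.HubbardSuperconductivity.HubbardSuperconductivity.Theorems.JosephsonMirrorJmCuspNormalForm
import Summits.HubbardSuperconductivity.HubbardSuperconductivity.Theorems.JosephsonMirrorJmPairBridgeLroFloorOfHasLRO
import Summits.HubbardSuperconductivity.HubbardSuperconductivity.Theorems.JosephsonMirrorGlue
import Literature.Barriers.HubbardSuperconductivity.PureModelStripeCompetitionProofs

/-!
# Route `JosephsonMirror` — crux `JmCusp` (stmt-HubbardSuperconductivity-2228), line `Sketch`:
# the SUMMIT SANDWICH of the bet

The crux `Theses.JosephsonMirror.JmCusp` ("the bet": some `U > 0`, `δ ∈ (0, 1/2)` carry (i) the uniform linear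
Josephson gain of the window double and (ii) eventual simplicity of the `(N_L, S^z = 0)` ground floor) is bracketed
by the summit's own matrix at a point, `Literature.Barriers.HubbardSuperconductivity.HasDWavePairFieldLROAt U δ`
(literally the body of `HubbardSuperconductivity` at fixed `(U, δ)`: every admissible sequence of normalised
`(N_L, S^z = 0)` sector ground states of `hubbardTorus 2 L 1 U` has `d_{x²-y²}` pair-field long-range order along the
even sides), by pure composition of landed theorems:

* `josephsonGain_of_hasDWavePairFieldLROAt` — FROM BELOW, clause (i) alone: the summit's matrix at `(U, δ)` implies
  the uniform linear Josephson gain at `(U, δ)` (clause (i) of `JmCusp` = the hypothesis of `JmInterchange`, verbatim).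
  Chain: `stub_lroFloorOfHasLRO` (matrix ⇒ uniform floor `aL⁴ ≤ ‖Δ_d φ‖²` on every unit ground state, crux
  `JmPairBridge`) ∘ existence of a unit sector ground state (`exists_unit_isGroundStateInSector_hubbardTorus`) ∘
  `zeroExcessPairOrder_of_floorOrder` ∘ `josephsonGain_iff_zeroExcessPairOrder`.  Contrapositive
  (`not_hasDWavePairFieldLROAt_of_not_josephsonGain`): NO Josephson cusp at `(U, δ)` REFUTES the summit's matrix
  there — the cusp is a necessary condition for `d`-wave pair-field LRO, point by point.
* `jmCusp_of_hasDWavePairFieldLROAt_and_simple` — FROM BELOW, the whole bet: the summit's matrix at some `(U, δ)`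
  together with eventual simplicity of the `(N_L, 0)` floor there (clause (ii) verbatim) gives `JmCusp`
  (`jmCusp_of_floorOrder_and_simple`).
* `summitMatrix_of_jmInterchange_of_jmCusp` — FROM ABOVE: given the sibling crux `JmInterchange`, `JmCusp` gives
  the summit-shaped statement `∃ U > 0, ∃ δ ∈ (0, 1/2), HasDWavePairFieldLROAt U δ` (the route's deciding theorem
  `Theses.JosephsonMirror.closes` with the landed `jmCruxGlue_proof`, `jmTargetToSummit_proof`, read through
  `HubbardSuperconductivity = ∃ (U, δ), HasDWavePairFieldLROAt U δ`, which holds by `rfl`).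

So (summit matrix at a point ∧ simplicity there) ⇒ `JmCusp` ⇒ [mod `JmInterchange`] (summit matrix at a point):
the crux is the summit's open problem at a clean, eventually simple `d`-wave point — no more and, up to the
interchange, no less.  Nothing here claims either side; no definition and no named fact is introduced.

Sources: T. Koma, H. Tasaki, J. Stat. Phys. 76 (1994) 745 (order parameters at vanishing excess energy);
D. J. Scalapino, Phys. Rep. 250 (1995) 329, §2 eq. (2.4) (pair-field LRO); H. Tasaki, *Physics and Mathematics of
Quantum Many-Body Systems* (2020) §2.1–2.2.  Mathlib/tree search: `stub_lroFloorOfHasLRO`,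
`exists_unit_isGroundStateInSector_hubbardTorus`, `natFloor_filling_le_sq`, `zeroExcessPairOrder_of_floorOrder`,
`josephsonGain_iff_zeroExcessPairOrder`, `jmCusp_of_floorOrder_and_simple`, `jmCruxGlue_proof`,
`jmTargetToSummit_proof` (all tree); nothing new from Mathlib.
-/

-- the mandated namespace `Summit.<Summit>.<Problem>.Theorems` repeats `HubbardSuperconductivity`
-- (single-problem summit, D-0017), which the `dupNamespace` linter flags on every declaration
set_option linter.dupNamespace false

namespace Summit.HubbardSuperconductivity.HubbardSuperconductivity.Theorems.JosephsonMirror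

open Matrix Literature.MathematicalPhysics.QuantumLattice Literature.Barriers.HubbardSuperconductivity

/-- **The summit's matrix at a point forces the Josephson cusp there (clause (i) from below).**  For `U > 0`,
`δ ∈ (0, 1/2)`: if every admissible sequence of normalised `(N_L, S^z = 0)` ground states of `hubbardTorus 2 L 1 U`
has `d`-wave pair-field LRO along the even sides (`HasDWavePairFieldLROAt U δ`, the body of the summit at `(U, δ)`),
then some `a, J₀ > 0` give the uniform linear Josephson gain `a J L² ≤ E_L(0) − E_L(J)` of the window double for
all `J ∈ (0, J₀]` and all large even `L` — clause (i) of `JmCusp`, equivalently the hypothesis of `JmInterchange`,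
verbatim.  Uniform floor of the matrix (`stub_lroFloorOfHasLRO`), a unit ground state in each sector
(`exists_unit_isGroundStateInSector_hubbardTorus`), zero excess of a ground state
(`zeroExcessPairOrder_of_floorOrder`) and the normal form `josephsonGain_iff_zeroExcessPairOrder`.
Koma–Tasaki, J. Stat. Phys. 76 (1994) 745; Scalapino, Phys. Rep. 250 (1995) 329, §2. [folklore] -/
theorem josephsonGain_of_hasDWavePairFieldLROAt : ∀ (U δ : ℝ), 0 < U → δ ∈ Set.Ioo (0:ℝ) (1 / 2) → Literature.Barriers.HubbardSuperconductivity.HasDWavePairFieldLROAt U δ → ∃ a J₀ : ℝ, 0 < a ∧ 0 < J₀ ∧ (∀ J ∈ Set.Ioc (0:ℝ) J₀, ∃ L₀ : ℕ, ∀ (L : ℕ) [NeZero L], Even L → L₀ ≤ L → (let ι : Type := Finset (Literature.MathematicalPhysics.QuantumLattice.Orb (Literature.MathematicalPhysics.QuantumLattice.FermionTorus 2 L)); let N : ℕ := 2 * ⌊(1 - δ) * (L : ℝ) ^ 2 / 2⌋₊; let H : Matrix ι ι ℂ := Literature.MathematicalPhysics.QuantumLattice.hubbardTorus 2 L 1 U;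 let μ : ℝ := (H.minEnergyOn (Literature.MathematicalPhysics.QuantumLattice.szSector N 0) - H.minEnergyOn (Literature.MathematicalPhysics.QuantumLattice.szSector (N - 2) 0)) / 2; let A : Matrix ι ι ℂ := Literature.MathematicalPhysics.QuantumLattice.hubbardTorusWith 2 L 1 U μ; let D : Matrix ι ι ℂ := ((L : ℂ))⁻¹ • Literature.MathematicalPhysics.QuantumLattice.pairField Literature.MathematicalPhysics.QuantumLattice.dWaveFormFactor L; let Hd : ℝ → Matrix (ι × ι) (ι × ι) ℂ := fun J => Matrix.kroneckerMap (fun a b : ℂ => a * b) A 1 + Matrix.kroneckerMap (fun a b : ℂ => a * b) 1 (Matrix.transpose A) - (J : ℂ) • (Matrix.kroneckerMap (fun a b : ℂ => a * b) D (Matrix.transpose (Matrix.conjTranspose D)) + Matrix.kroneckerMap (fun a b : ℂ => a * b) (Matrix.conjTranspose D) (Matrix.transpose D)); let good : ι × ι → Prop := fun p => ((p.1.card = N ∧ p.2.card = N) ∨ (p.1.card = N - 2 ∧ p.2.card = N - 2)) ∧ (p.1.filter (fun o => (ofLex o).2 = 0)).card = (p.1.filter (fun o => (ofLex o).2 = 1)).card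 ∧ (p.2.filter (fun o => (ofLex o).2 = 0)).card = (p.2.filter (fun o => (ofLex o).2 = 1)).card; let S : Submodule ℂ (ι × ι → ℂ) := ⨅ (p : ι × ι) (_ : ¬ good p), LinearMap.ker (LinearMap.proj (R := ℂ) (φ := fun _ : ι × ι => ℂ) p); let E : ℝ → ℝ := fun J => (Hd J).minEnergyOn S; a * J * (L : ℝ) ^ 2 ≤ E 0 - E J)) := by
  intro U δ hU hδ h
  obtain ⟨a, ha, L₀, hfloor⟩ := stub_lroFloorOfHasLRO U δ hδ.1.le h
  refine (josephsonGain_iff_zeroExcessPairOrder U δ hU hδ).2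
    (zeroExcessPairOrder_of_floorOrder U δ ⟨a, ha, L₀, fun L _ hE hL => ?_⟩)
  obtain ⟨g, hg1, hgs⟩ := exists_unit_isGroundStateInSector_hubbardTorus U L ⌊(1 - δ) * (L : ℝ) ^ 2 / 2⌋₊
    (natFloor_filling_le_sq (δ := δ) (by linarith [hδ.1]) L)
  exact ⟨g, hgs, hg1, hfloor L hE hL g hgs hg1⟩

/-- **No cusp, no summit at that point.**  Contrapositive of `josephsonGain_of_hasDWavePairFieldLROAt`: for
`U > 0`, `δ ∈ (0, 1/2)`, if NO `a, J₀ > 0` give the uniform linear Josephson gain of the window double at `(U, δ)`,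
then the summit's matrix fails at `(U, δ)` — some admissible sequence of normalised `(N_L, S^z = 0)` ground states
lacks `d`-wave pair-field long-range order.  Koma–Tasaki, J. Stat. Phys. 76 (1994) 745. [folklore] -/
theorem not_hasDWavePairFieldLROAt_of_not_josephsonGain : ∀ (U δ : ℝ), 0 < U → δ ∈ Set.Ioo (0:ℝ) (1 / 2) → (¬ ∃ a J₀ : ℝ, 0 < a ∧ 0 < J₀ ∧ (∀ J ∈ Set.Ioc (0:ℝ) J₀, ∃ L₀ : ℕ, ∀ (L : ℕ) [NeZero L], Even L → L₀ ≤ L → (let ι : Type := Finset (Literature.MathematicalPhysics.QuantumLattice.Orb (Literature.MathematicalPhysics.QuantumLattice.FermionTorus 2 L)); let N : ℕ := 2 * ⌊(1 - δ) * (L : ℝ) ^ 2 / 2⌋₊; let H : Matrix ι ι ℂ := Literature.MathematicalPhysics.QuantumLattice.hubbardTorus 2 L 1 U; let μ : ℝ := (H.minEnergyOn (Literature.MathematicalPhysics.QuantumLattice.szSector N 0) - H.minEnergyOn (Literature.MathematicalPhysics.QuantumLattice.szSector (N - 2) 0)) / 2; let A : Matrix ι ι ℂ := Literature.MathematicalPhysics.QuantumLattice.hubbardTorusWith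 2 L 1 U μ; let D : Matrix ι ι ℂ := ((L : ℂ))⁻¹ • Literature.MathematicalPhysics.QuantumLattice.pairField Literature.MathematicalPhysics.QuantumLattice.dWaveFormFactor L; let Hd : ℝ → Matrix (ι × ι) (ι × ι) ℂ := fun J => Matrix.kroneckerMap (fun a b : ℂ => a * b) A 1 + Matrix.kroneckerMap (fun a b : ℂ => a * b) 1 (Matrix.transpose A) - (J : ℂ) • (Matrix.kroneckerMap (fun a b : ℂ => a * b) D (Matrix.transpose (Matrix.conjTranspose D)) + Matrix.kroneckerMap (fun a b : ℂ => a * b) (Matrix.conjTranspose D) (Matrix.transpose D)); let good : ι × ι → Prop := fun p => ((p.1.card = N ∧ p.2.card = N) ∨ (p.1.card = N - 2 ∧ p.2.card = N - 2)) ∧ (p.1.filter (fun o => (ofLex o).2 = 0)).card = (p.1.filter (fun o => (ofLex o).2 = 1)).card ∧ (p.2.filter (fun o => (ofLex o).2 = 0)).card = (p.2.filter (fun o => (ofLex o).2 = 1)).card; let S : Submodule ℂ (ι × ι → ℂ) := ⨅ (p : ι × ι) (_ : ¬ good p), LinearMap.ker (LinearMap.proj (R := ℂ) (φ := fun _ :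 ι × ι => ℂ) p); let E : ℝ → ℝ := fun J => (Hd J).minEnergyOn S; a * J * (L : ℝ) ^ 2 ≤ E 0 - E J))) → ¬ Literature.Barriers.HubbardSuperconductivity.HasDWavePairFieldLROAt U δ :=
  fun U δ hU hδ hno h => hno (josephsonGain_of_hasDWavePairFieldLROAt U δ hU hδ h)

/-- **The bet from below: the summit at an eventually simple point.**  If at some `U > 0`, `δ ∈ (0, 1/2)` the
summit's matrix `HasDWavePairFieldLROAt U δ` holds AND the `(N_L, S^z = 0)` ground state of `hubbardTorus 2 L 1 U`
is eventually (in even `L`) unique up to scalars (clause (ii) of `JmCusp`, verbatim), then `JmCusp` holds.  Uniform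
floor of the matrix (`stub_lroFloorOfHasLRO`) on a chosen unit ground state of each sector
(`exists_unit_isGroundStateInSector_hubbardTorus`), then `jmCusp_of_floorOrder_and_simple`.
Koma–Tasaki, J. Stat. Phys. 76 (1994) 745; Scalapino, Phys. Rep. 250 (1995) 329, §2. [folklore] -/
theorem jmCusp_of_hasDWavePairFieldLROAt_and_simple : (∃ U : ℝ, 0 < U ∧ ∃ δ ∈ Set.Ioo (0:ℝ) (1 / 2), Literature.Barriers.HubbardSuperconductivity.HasDWavePairFieldLROAt U δ ∧ (∃ L₀ : ℕ, ∀ (L : ℕ), Even L → L₀ ≤ L → ∀ φ φ' : Literature.MathematicalPhysics.QuantumLattice.Fock (Literature.MathematicalPhysics.QuantumLattice.Orb (Literature.MathematicalPhysics.QuantumLattice.FermionTorus 2 L)), Literature.MathematicalPhysics.QuantumLattice.IsGroundStateInSector (Literature.MathematicalPhysics.QuantumLattice.hubbardTorus 2 L 1 U) (2 * ⌊(1 - δ) * (L : ℝ) ^ 2 / 2⌋₊) 0 φ → Literature.MathematicalPhysics.QuantumLattice.IsGroundStateInSector (Literature.MathematicalPhysics.QuantumLattice.hubbardTorus 2 L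 1 U) (2 * ⌊(1 - δ) * (L : ℝ) ^ 2 / 2⌋₊) 0 φ' → ∃ c : ℂ, φ' = c • φ)) → Summit.HubbardSuperconductivity.HubbardSuperconductivity.Theses.JosephsonMirror.JmCusp := by
  rintro ⟨U, hU, δ, hδ, h, hS⟩
  obtain ⟨a, ha, L₀, hfloor⟩ := stub_lroFloorOfHasLRO U δ hδ.1.le h
  refine jmCusp_of_floorOrder_and_simple ⟨U, hU, δ, hδ, ⟨a, ha, L₀, fun L _ hE hL => ?_⟩, hS⟩
  obtain ⟨g, hg1, hgs⟩ := exists_unit_isGroundStateInSector_hubbardTorus U L ⌊(1 - δ) * (L : ℝ) ^ 2 / 2⌋₊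
    (natFloor_filling_le_sq (δ := δ) (by linarith [hδ.1]) L)
  exact ⟨g, hgs, hg1, hfloor L hE hL g hgs hg1⟩

/-- **The bet from above, modulo the interchange.**  Given the sibling crux `JmInterchange`, the bet `JmCusp`
yields the summit-shaped statement `∃ U > 0, ∃ δ ∈ (0, 1/2), HasDWavePairFieldLROAt U δ`: the route's deciding
theorem `Theses.JosephsonMirror.closes` fed with the landed `jmCruxGlue_proof` and `jmTargetToSummit_proof`,
its conclusion `HubbardSuperconductivity` being by definition `∃ (U, δ), HasDWavePairFieldLROAt U δ`.  Together
with `jmCusp_of_hasDWavePairFieldLROAt_and_simple`: (summit matrix ∧ simplicity at a point) ⇒ `JmCusp` ⇒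
[mod `JmInterchange`] (summit matrix at a point).  Scalapino, Phys. Rep. 250 (1995) 329, §2. [folklore] -/
theorem summitMatrix_of_jmInterchange_of_jmCusp : Summit.HubbardSuperconductivity.HubbardSuperconductivity.Theses.JosephsonMirror.JmInterchange → Summit.HubbardSuperconductivity.HubbardSuperconductivity.Theses.JosephsonMirror.JmCusp → ∃ U : ℝ, 0 < U ∧ ∃ δ ∈ Set.Ioo (0:ℝ) (1 / 2), Literature.Barriers.HubbardSuperconductivity.HasDWavePairFieldLROAt U δ :=
  fun hI hC =>
    Summit.HubbardSuperconductivity.HubbardSuperconductivity.Theses.JosephsonMirror.closes hI hC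
      jmCruxGlue_proof jmTargetToSummit_proof

end Summit.HubbardSuperconductivity.HubbardSuperconductivity.Theorems.JosephsonMirror
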